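import Literature.NumberTheory.LFunctions.JensenDegreeDescent
import Literature.NumberTheory.LFunctions.JensenXiLowStretchFour
import Literature.NumberTheory.LFunctions.JensenXiFiniteStretchSeven
import Literature.NumberTheory.LFunctions.JensenXiFiniteStretchEight
import HarnessLib

/-!
# Assemblies across degrees: one analytic tail row + enclosures give every degree below

`JensenDegreeDescent.lean` proves that hyperbolicity of `J^{d,n}_γ` descends in `d` at fixed `n`
(`splits_jensenPoly_of_le`). Hence the three kinds of input of the Jensen track — per-shift certificates
below `10⁴`, hull-box enclosures on a finite stretch, an analytic tail `JensenHyperbolicFrom γ d N` —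
need only be supplied at the TOP degree of interest. This file packages, GENERICALLY IN THE TAIL
THRESHOLD `N` (so that whichever ladder box / Theorem-A row lands plugs in):

* `jensenXiAllShifts_le_eight_of_tail` : `N ≤ 3000001` → shifts `< 10⁴` at `d = 8` → the `d = 8` hull
  enclosure on `[10⁴, 3·10⁶]` (`XiMomentsInHullEight`) → `JensenHyperbolicFrom xiTaylorCoeff 8 N` →
  `JensenXiAllShifts d` for every `d ≤ 8`;
* `jensenXiAllShifts_le_seven_of_tail` : the same at `d = 7` with the hull on `[10⁴, 2·10⁶]`
  (`XiMomentsInHullSeven`, `N ≤ 2000001`);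
* `jensenXiAllShifts_le_four_of_tail` : at `d = 4` with ENCLOSURES ONLY below the tail (coefficient balls
  `xiBoxStage1e3.Encloses xiTaylorCoeff` for `n < 104`, hulls `XiMomentsInHullFourLow` on `[104, 9999]` and
  `XiMomentsInHullFour` on `[10⁴, 10⁵]`, `N ≤ 100001`) → every `d ≤ 4` — with the track's Theorem A row
  «`∀ n ≥ 10⁵, LadderMomentBounds 4 blLadderConst (3/20) (1/141) n`» this is "`J^{d,n}_ξ` hyperbolic for all
  `n` and all `d ≤ 4`" under certified-numerics enclosures alone (in particular the Turán inequalities,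
  `d = 2`, and `d = 3` for every shift);
* the tails and finite ranges themselves descend: `jensenHyperbolicFrom_of_le`, `jensenHyperbolicBelow_of_le`
  (re-exported instances for `ξ`).

No input on the zeros of `ζ` anywhere. [Degree descent: Craven–Csordas 1989 §1; assembly pattern:
Griffin–Ono–Rolen–Zagier 2019, Thm. 2.]

## References
* [CravenCsordas1989] T. Craven, G. Csordas, Pacific J. Math. 136 (1989), §1 (i), §2.
* [GORZPNAS2019] Griffin–Ono–Rolen–Zagier, PNAS 116 (2019), Thms. 2, 3, §5.2.
-/

open Polynomial Finset

namespace Literature.NumberTheory.LFunctions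

/-- **Top degree `8` ⇒ all `d ≤ 8`** (generic tail threshold `N ≤ 3000001`): per-shift certificates below
`10⁴` at degree `8`, the degree-`8` hull enclosure on `[10⁴, 3·10⁶]`, and a hyperbolic degree-`8` tail from
`N` give `J^{d,n}_γ` hyperbolic for every `n` and every `d ≤ 8`. [cite: GORZPNAS2019, Thm. 2 and §5.2] -/
theorem jensenXiAllShifts_le_eight_of_tail {N : ℕ} (hN : N ≤ 3000001)
    (h0 : JensenHyperbolicBelow xiTaylorCoeff 8 10000) (h1 : XiMomentsInHullEight)
    (h2 : JensenHyperbolicFrom xiTaylorCoeff 8 N) {d : ℕ} (hd : d ≤ 8) : JensenXiAllShifts d := by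
  refine jensenXiAllShifts_of_le hd fun n => ?_
  by_cases hlow : n < 10000
  · exact h0 n hlow
  · by_cases hmid : n ≤ 3000000
    · exact jensenPoly_eight_splits_on_stretch h1 (by omega) hmid
    · exact h2 n (by omega)

/-- **Top degree `7` ⇒ all `d ≤ 7`** (generic tail threshold `N ≤ 2000001`; hull on `[10⁴, 2·10⁶]`).
[cite: GORZPNAS2019, Thm. 2 and §5.2] -/
theorem jensenXiAllShifts_le_seven_of_tail {N : ℕ} (hN : N ≤ 2000001)
    (h0 : JensenHyperbolicBelow xiTaylorCoeff 7 10000) (h1 : XiMomentsInHullSeven)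
    (h2 : JensenHyperbolicFrom xiTaylorCoeff 7 N) {d : ℕ} (hd : d ≤ 7) : JensenXiAllShifts d := by
  refine jensenXiAllShifts_of_le hd fun n => ?_
  by_cases hlow : n < 10000
  · exact h0 n hlow
  · by_cases hmid : n ≤ 2000000
    · exact jensenPoly_seven_splits_on_stretch h1 (by omega) hmid
    · exact h2 n (by omega)

/-- **Top degree `4` ⇒ all `d ≤ 4`, enclosures only below the tail** (generic tail threshold
`N ≤ 100001`): coefficient balls for `n < 104`, moment hulls on `[104, 9999]` and `[10⁴, 10⁵]`, and a
hyperbolic degree-`4` tail from `N` give every `d ≤ 4` and every `n` — e.g. with the track's analytic row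
from `10⁵`. [cite: GORZPNAS2019, Thm. 2 and §5.2] -/
theorem jensenXiAllShifts_le_four_of_tail {N : ℕ} (hN : N ≤ 100001)
    (hγ : xiBoxStage1e3.Encloses xiTaylorCoeff) (hlow : XiMomentsInHullFourLow)
    (h1 : XiMomentsInHullFour) (h2 : JensenHyperbolicFrom xiTaylorCoeff 4 N) {d : ℕ} (hd : d ≤ 4) :
    JensenXiAllShifts d := by
  refine jensenXiAllShifts_of_le hd fun n => ?_
  by_cases hlow' : n < 10000
  · exact jensenHyperbolicBelow_four_of_box_of_hulls hγ hlow n hlow'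
  · by_cases hmid : n ≤ 100000
    · exact jensenPoly_four_splits_on_stretch h1 (by omega) hmid
    · exact h2 n (by omega)

/-- **The ladder tail of record at `d = 4` gives every `d ≤ 4`:** «`∀ n ≥ N, LadderMomentBounds 4
blLadderConst (3/20) (1/141) n`» ⇒ `J^{d,n}_γ` hyperbolic for all `n ≥ N`, `d ≤ 4`.
[cite: GORZPNAS2019, Thm. 2 and §5.2] -/
theorem jensenHyperbolicFrom_le_four_of_ladderMomentBounds {N : ℕ}
    (h : ∀ n : ℕ, N ≤ n → LadderMomentBounds 4 blLadderConst (3 / 20) (1 / 141) n) {d : ℕ} (hd : d ≤ 4) :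
    JensenHyperbolicFrom xiTaylorCoeff d N :=
  jensenHyperbolicFrom_of_le hd (jensenHyperbolicFrom_four_of_ladderMomentBounds_from h)

/-- **All of it at `d ≤ 4` from the analytic row at `10⁵` plus enclosures:** the form in which the track's
Theorem A (row `d = 4`, `N = 10⁵`) closes degrees `1, 2, 3, 4` for every shift.
[cite: GORZPNAS2019, Thm. 2 and §5.2] -/
theorem jensenXiAllShifts_le_four_of_enclosures_of_ladder (hγ : xiBoxStage1e3.Encloses xiTaylorCoeff)
    (hlow : XiMomentsInHullFourLow) (h1 : XiMomentsInHullFour)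
    (h2 : ∀ n : ℕ, 100000 ≤ n → LadderMomentBounds 4 blLadderConst (3 / 20) (1 / 141) n) {d : ℕ}
    (hd : d ≤ 4) : JensenXiAllShifts d :=
  jensenXiAllShifts_le_four_of_tail (N := 100000) (by norm_num) hγ hlow h1
    (jensenHyperbolicFrom_four_of_ladderMomentBounds_from h2) hd

end Literature.NumberTheory.LFunctions
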